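import Mathlib
import HarnessLib
import Summits.Ventures.LatticeQCDFlow.Exactness.SphereLOFlowL1Stability
import Summits.Ventures.LatticeQCDFlow.Exactness.LatticeBoundedDifferences
import Summits.Ventures.LatticeQCDFlow.Exactness.SphereFlowLiouvilleMeasure

/-!
# The log-Jacobian of the exact leading-order trivializing flow is `∫_0^c (S∘Φ_{0→u} − S₀) du`, `ℓ¹`-Lipschitz with constant `2|κ|υ·c·e^{Kc}`, and fluctuates like `c√|Λ|` — one order in the flow time MORE than the effective action `c·S∘Φ_{0→c} − ℓ_{0→c}`

HONEST FRAMING: exact (Metropolis-corrected) sampling algorithms for lattice gauge theory;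
figures of merit are autocorrelation/cost numbers at stated couplings and volumes; no
continuum-physics claim.

Venture `LatticeQCDFlow` (cell pub-lqcd), topic `Exactness`; FANOUT row 7 (`s0-cpn-null`: the
S0-D1 rung — 2D CP⁹, Lüscher's LO trivializing map inside HMC, Engel–Schaefer 2011).  NEW WORK of
the cell over this leg's `Exactness/SphereLOFlowL1Stability.lean` (`ℓ¹`-stability of the exact LO
flow, rate `K = 3|κ|υ/(d−1)`; column sums of the couplings) and
`Exactness/LatticeBoundedDifferences.lean` (Efron–Stein–Popoviciu variance bound for
bounded-difference functionals), GEN-15's `Exactness/SphereFlowLiouville.lean` (the log-Jacobian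
`ℓ_{s→c} = −∫_s^c Σ_n∂̃²_nG_u∘Φ_{s→u} du`, Liouville's formula) and GEN-5's
`Exactness/SphereLOFlowAction.lean` (`−Σ_n∂̃²_nS̃⁽⁰⁾ = S − S₀` on `Ω̃`: Lüscher's equation at leading
order); nothing is cited as a fact.  Printed counterpart, NAMED ONLY: M. Lüscher, Commun. Math.
Phys. 293 (2010) 899, §3.2 eq. (3.7)–(3.9) (the Jacobian of the flow), Engel–Schaefer 2011 §3
eq. (15)/(18).  GEN-15's HANDOFF follow-up (c) asked for "LOCALITY of `ln J`": here is its
`ℓ¹`-stability in the initial configuration with a volume-independent constant, and the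
comparison of orders in `c` between `ln J`, the flowed action and their difference.

## Content (E–S action, `d ≥ 2`, no self-coupling, adjoint pairs, local weight `Σ_m‖U_km‖ ≤ υ`;
## `Φ_{0→u}` the exact flow of the constant generator `S̃⁽⁰⁾`, `K = 3|κ|υ/(d−1)`)

* **`abs_esAction_sub_le`** — THE ACTION IS `ℓ¹`-LIPSCHITZ ON `Ω̃`: `|S(x) − S(y)| ≤ 2|κ|υ·Σ_j‖x_j − y_j‖`.
* **`sphereTDFlowLogJac_loFlow_eq`** — THE LOG-JACOBIAN OF THE LO FLOW IN CLOSED FORM: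
  `ℓ_{0→c}(x) = ∫_0^c (S(Φ_{0→u}x) − S₀) du` for `x ∈ Ω̃` and every real `c` (Liouville + Lüscher's
  LO equation `−Σ∂̃²S̃⁽⁰⁾ = S − S₀`).
* **`abs_logJac_loFlow_sub_le`** — `|ℓ_{0→c}(x) − ℓ_{0→c}(y)| ≤ 2|κ|υ·c·e^{Kc}·Σ_j‖x_j − y_j‖`
  (`c ≥ 0`); **`abs_action_comp_loFlow_sub_le`** — `|S(Φ_{0→c}x) − S(Φ_{0→c}y)| ≤ 2|κ|υ·e^{Kc}·Σ_j‖x_j − y_j‖`.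
* **`variance_logJac_loFlow_le`** — `Var_π̄(ℓ_{0→c}) ≤ |Λ|·(4|κ|υ·c·e^{Kc})²/4 = 4|Λ|κ²υ²c²e^{2Kc}`:
  the log-Jacobian ALONE fluctuates like `c·√|Λ|`, whereas the effective action
  `c·S∘Φ_{0→c} − ℓ_{0→c}` fluctuates like `c²·√|Λ|` (`SphereLOFlowEffectiveActionConcentration`):
  the leading-order trivialization cancels exactly one order in the flow time.

NOT CLAIMED: lower bounds; the one-step map's Jacobian (GEN-6/GEN-9); numbers of the rung.
-/

noncomputable section

namespace Summit.Ventures.LatticeQCDFlow.Exactness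

open Function Set Metric MeasureTheory NormedSpace InnerProductSpace
open scoped RealInnerProductSpace Topology

variable {Λ : Type*} {E : Type*} [NormedAddCommGroup E] [InnerProductSpace ℝ E]
  [FiniteDimensional ℝ E] [Fintype Λ] [DecidableEq Λ] {U : Λ → Λ → (E →L[ℝ] E)} {T : ℝ}

/-! ## §1 The action is `ℓ¹`-Lipschitz on `Ω̃` -/

omit [DecidableEq Λ] in
/-- **`|S(x) − S(y)| ≤ 2|κ|υ·Σ_j‖x_j − y_j‖` on `Ω̃`** (`S = −κΣ_n⟪x_n, J_n x⟫ + S₀`; adjoint-pair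
couplings of local weight `≤ υ`; no self-coupling is not needed). -/
theorem abs_esAction_sub_le (hUadj : ∀ m n (v w : E), ⟪U m n v, w⟫ = ⟪v, U n m w⟫) (κ S₀ : ℝ)
    {υ : ℝ} (hυ : ∀ k, ∑ m, ‖U k m‖ ≤ υ) {x y : Λ → E} (hx : ∀ n, ‖x n‖ = 1) (hy : ∀ n, ‖y n‖ = 1) :
    |esAction κ S₀ U x - esAction κ S₀ U y| ≤ 2 * |κ| * υ * ∑ j, ‖x j - y j‖ := by
  have e : esAction κ S₀ U x - esAction κ S₀ U y =
      -κ * ∑ n, (⟪x n, localField U n x⟫ - ⟪y n, localField U n y⟫) := by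
    simp only [esAction, Finset.sum_sub_distrib]; ring
  rw [e, abs_mul, abs_neg]
  -- per site: `|⟪x_n, J_n x⟫ − ⟪y_n, J_n y⟫| ≤ ‖x_n − y_n‖·υ + Σ_m ‖U_nm‖‖x_m − y_m‖`
  have hsite : ∀ n, |⟪x n, localField U n x⟫ - ⟪y n, localField U n y⟫| ≤
      υ * ‖x n - y n‖ + ∑ m, ‖U n m‖ * ‖x m - y m‖ := by
    intro n
    have e' : ⟪x n, localField U n x⟫ - ⟪y n, localField U n y⟫ =
        ⟪x n - y n, localField U n x⟫ + ⟪y n, localField U n x - localField U n y⟫ := by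
      rw [inner_sub_left, inner_sub_right]; ring
    rw [e']
    refine (abs_add_le _ _).trans (add_le_add ?_ ?_)
    · calc |⟪x n - y n, localField U n x⟫| ≤ ‖x n - y n‖ * ‖localField U n x‖ :=
            abs_real_inner_le_norm _ _
        _ ≤ ‖x n - y n‖ * υ := by gcongr; exact norm_localField_le hυ hx n
        _ = υ * ‖x n - y n‖ := mul_comm _ _
    · calc |⟪y n, localField U n x - localField U n y⟫| ≤ ‖y n‖ * ‖localField U n x - localField U n y‖ :=
            abs_real_inner_le_norm _ _
        _ ≤ 1 * ∑ m, ‖U n m‖ * ‖x m - y m‖ := by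
            rw [hy n]; exact mul_le_mul_of_nonneg_left (norm_localField_sub_le U n x y) zero_le_one
        _ = _ := one_mul _
  have hsum : |∑ n, (⟪x n, localField U n x⟫ - ⟪y n, localField U n y⟫)| ≤ 2 * υ * ∑ j, ‖x j - y j‖ := by
    refine (Finset.abs_sum_le_sum_abs _ _).trans ?_
    calc ∑ n, |⟪x n, localField U n x⟫ - ⟪y n, localField U n y⟫|
        ≤ ∑ n, (υ * ‖x n - y n‖ + ∑ m, ‖U n m‖ * ‖x m - y m‖) := Finset.sum_le_sum fun n _ => hsite n
      _ = υ * ∑ n, ‖x n - y n‖ + ∑ m, (∑ n, ‖U n m‖) * ‖x m - y m‖ := by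
          rw [Finset.sum_add_distrib, ← Finset.mul_sum, Finset.sum_comm]
          congr 1
          exact Finset.sum_congr rfl fun m _ => by rw [Finset.sum_mul]
      _ ≤ υ * ∑ n, ‖x n - y n‖ + ∑ m, υ * ‖x m - y m‖ := by
          gcongr with m _
          exact sum_norm_coupling_col_le hUadj hυ m
      _ = 2 * υ * ∑ j, ‖x j - y j‖ := by rw [← Finset.mul_sum]; ring
  calc |κ| * |∑ n, (⟪x n, localField U n x⟫ - ⟪y n, localField U n y⟫)|
      ≤ |κ| * (2 * υ * ∑ j, ‖x j - y j‖) := mul_le_mul_of_nonneg_left hsum (abs_nonneg _)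
    _ = 2 * |κ| * υ * ∑ j, ‖x j - y j‖ := by ring

/-! ## §2 The log-Jacobian of the exact LO flow in closed form and its `ℓ¹`-stability -/

/-- **THE LOG-JACOBIAN OF THE LO FLOW IN CLOSED FORM**: for `x ∈ Ω̃` and every real `c`,
`ℓ_{0→c}(x) = ∫_0^c (S(Φ_{0→u}x) − S₀) du` (Liouville's formula `ℓ = −∫Σ∂̃²S̃⁽⁰⁾∘Φ` and Lüscher's
leading-order equation `−Σ_n∂̃²_nS̃⁽⁰⁾ = S − S₀` on `Ω̃`). -/
theorem sphereTDFlowLogJac_loFlow_eq (hU0 : ∀ n, U n n = 0)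
    (hUadj : ∀ m n (v w : E), ⟪U m n v, w⟫ = ⟪v, U n m w⟫) (hd : 2 ≤ Module.finrank ℝ E)
    (κ S₀ : ℝ) {x : Λ → E} (hx : ∀ n, ‖x n‖ = 1) (c : ℝ) :
    sphereTDFlowLogJac (G := fun _ : ℝ => loFlowAction κ S₀ U)
        (contDiff_const_family (contDiff_loFlowAction U κ S₀)) T 0 c x =
      ∫ u in (0 : ℝ)..c, (esAction κ S₀ U (sphereTDFlow (G := fun _ : ℝ => loFlowAction κ S₀ U)
        (contDiff_const_family (contDiff_loFlowAction U κ S₀)) T 0 u x) - S₀) := by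
  rw [sphereTDFlowLogJac_eq_of_norm_eq_one _ 0 c hx, ← intervalIntegral.integral_neg]
  refine intervalIntegral.integral_congr fun u _ => ?_
  exact neg_sum_siteLaplacian_loFlowAction hU0 hUadj hd κ S₀
    (fun n => norm_sphereTDFlow_eq_one _ 0 hx u n)

/-- **THE FLOWED ACTION IS `ℓ¹`-LIPSCHITZ**: `|S(Φ_{t₀→t₁}x) − S(Φ_{t₀→t₁}y)| ≤ 2|κ|υ·e^{K|t₁−t₀|}·Σ_j‖x_j − y_j‖`
on `Ω̃`, `K = 3|κ|υ/(d−1)`. -/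
theorem abs_action_comp_loFlow_sub_le (hU0 : ∀ n, U n n = 0)
    (hUadj : ∀ m n (v w : E), ⟪U m n v, w⟫ = ⟪v, U n m w⟫) (hd : 2 ≤ Module.finrank ℝ E)
    (κ S₀ : ℝ) {υ : ℝ} (hυ : ∀ k, ∑ m, ‖U k m‖ ≤ υ)
    {x y : Λ → E} (hx : ∀ n, ‖x n‖ = 1) (hy : ∀ n, ‖y n‖ = 1) (t₀ t₁ : ℝ) :
    |esAction κ S₀ U (sphereTDFlow (G := fun _ : ℝ => loFlowAction κ S₀ U)
          (contDiff_const_family (contDiff_loFlowAction U κ S₀)) T t₀ t₁ x) -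
        esAction κ S₀ U (sphereTDFlow (G := fun _ : ℝ => loFlowAction κ S₀ U)
          (contDiff_const_family (contDiff_loFlowAction U κ S₀)) T t₀ t₁ y)| ≤
      2 * |κ| * υ * Real.exp (3 * |κ| * υ / ((Module.finrank ℝ E : ℝ) - 1) * |t₁ - t₀|) *
        ∑ j, ‖x j - y j‖ := by
  have hx1 : ∀ n, ‖sphereTDFlow (G := fun _ : ℝ => loFlowAction κ S₀ U)
      (contDiff_const_family (contDiff_loFlowAction U κ S₀)) T t₀ t₁ x n‖ = 1 :=
    fun n => norm_sphereTDFlow_eq_one _ t₀ hx t₁ n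
  have hy1 : ∀ n, ‖sphereTDFlow (G := fun _ : ℝ => loFlowAction κ S₀ U)
      (contDiff_const_family (contDiff_loFlowAction U κ S₀)) T t₀ t₁ y n‖ = 1 :=
    fun n => norm_sphereTDFlow_eq_one _ t₀ hy t₁ n
  have h1 := abs_esAction_sub_le hUadj κ S₀ hυ hx1 hy1
  have h2 := sum_norm_loFlow_sub_le hU0 hUadj hd κ S₀ hυ hx hy t₀ t₁ (T := T)
  rcases isEmpty_or_nonempty Λ with hΛ | hΛ
  · have hxy : x = y := funext fun n => isEmptyElim n
    subst hxy
    simp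
  have hυ0 : 0 ≤ υ :=
    le_trans (Finset.sum_nonneg fun m _ => norm_nonneg _) (hυ (Classical.arbitrary Λ))
  calc _ ≤ 2 * |κ| * υ * ∑ j, ‖sphereTDFlow (G := fun _ : ℝ => loFlowAction κ S₀ U)
            (contDiff_const_family (contDiff_loFlowAction U κ S₀)) T t₀ t₁ x j -
          sphereTDFlow (G := fun _ : ℝ => loFlowAction κ S₀ U)
            (contDiff_const_family (contDiff_loFlowAction U κ S₀)) T t₀ t₁ y j‖ := h1
    _ ≤ 2 * |κ| * υ * (Real.exp (3 * |κ| * υ / ((Module.finrank ℝ E : ℝ) - 1) * |t₁ - t₀|) *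
          ∑ j, ‖x j - y j‖) := mul_le_mul_of_nonneg_left h2 (by positivity)
    _ = _ := by ring

/-- **THE LOG-JACOBIAN OF THE EXACT LO FLOW IS `ℓ¹`-LIPSCHITZ IN THE INITIAL CONFIGURATION**: for
`0 ≤ c` and `x, y ∈ Ω̃`, `|ℓ_{0→c}(x) − ℓ_{0→c}(y)| ≤ 2|κ|υ·c·e^{Kc}·Σ_j‖x_j − y_j‖`, `K = 3|κ|υ/(d−1)`
— FIRST order in the flow time (the effective action `c·S∘Φ_{0→c} − ℓ_{0→c}` is second order,
`SphereLOFlowL1Stability.abs_effAction_loFlow_sub_le`). -/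
theorem abs_logJac_loFlow_sub_le (hU0 : ∀ n, U n n = 0)
    (hUadj : ∀ m n (v w : E), ⟪U m n v, w⟫ = ⟪v, U n m w⟫) (hd : 2 ≤ Module.finrank ℝ E)
    (κ S₀ : ℝ) {υ : ℝ} (hυ : ∀ k, ∑ m, ‖U k m‖ ≤ υ)
    {x y : Λ → E} (hx : ∀ n, ‖x n‖ = 1) (hy : ∀ n, ‖y n‖ = 1) {c : ℝ} (hc0 : 0 ≤ c) :
    |sphereTDFlowLogJac (G := fun _ : ℝ => loFlowAction κ S₀ U)
          (contDiff_const_family (contDiff_loFlowAction U κ S₀)) T 0 c x -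
        sphereTDFlowLogJac (G := fun _ : ℝ => loFlowAction κ S₀ U)
          (contDiff_const_family (contDiff_loFlowAction U κ S₀)) T 0 c y| ≤
      2 * |κ| * υ * c * Real.exp (3 * |κ| * υ / ((Module.finrank ℝ E : ℝ) - 1) * c) *
        ∑ j, ‖x j - y j‖ := by
  rcases isEmpty_or_nonempty Λ with hΛ | hΛ
  · have hxy : x = y := funext fun n => isEmptyElim n
    subst hxy
    simp
  have hυ0 : 0 ≤ υ :=
    le_trans (Finset.sum_nonneg fun m _ => norm_nonneg _) (hυ (Classical.arbitrary Λ))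
  have hd1 : 0 < (Module.finrank ℝ E : ℝ) - 1 := by
    have : (2 : ℝ) ≤ Module.finrank ℝ E := by exact_mod_cast hd
    linarith
  rw [sphereTDFlowLogJac_loFlow_eq hU0 hUadj hd κ S₀ hx c, sphereTDFlowLogJac_loFlow_eq hU0 hUadj hd κ S₀ hy c]
  set Φ : ℝ → (Λ → E) → (Λ → E) := fun u z => sphereTDFlow (G := fun _ : ℝ => loFlowAction κ S₀ U)
    (contDiff_const_family (contDiff_loFlowAction U κ S₀)) T 0 u z with hΦ
  set K : ℝ := 3 * |κ| * υ / ((Module.finrank ℝ E : ℝ) - 1) with hK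
  set L : ℝ := ∑ j, ‖x j - y j‖ with hL
  set B : ℝ := 2 * |κ| * υ * Real.exp (K * c) * L with hB
  have hK0 : 0 ≤ K := div_nonneg (by positivity) hd1.le
  have hL0 : 0 ≤ L := Finset.sum_nonneg fun j _ => norm_nonneg _
  have hcont : ∀ z : Λ → E, Continuous fun u : ℝ => esAction κ S₀ U (Φ u z) - S₀ := by
    intro z
    have hΦc : Continuous fun u : ℝ => Φ u z :=
      continuous_sphereTDFlow_time (contDiff_const_family (contDiff_loFlowAction U κ S₀)) 0 z
    exact ((contDiff_esAction U κ S₀ (m := 0)).continuous.comp hΦc).sub continuous_const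
  have hpt : ∀ u ∈ Icc 0 c, |(esAction κ S₀ U (Φ u x) - S₀) - (esAction κ S₀ U (Φ u y) - S₀)| ≤ B := by
    intro u hu
    have e : (esAction κ S₀ U (Φ u x) - S₀) - (esAction κ S₀ U (Φ u y) - S₀) =
        esAction κ S₀ U (Φ u x) - esAction κ S₀ U (Φ u y) := by ring
    rw [e]
    have h := abs_action_comp_loFlow_sub_le hU0 hUadj hd κ S₀ hυ hx hy 0 u (T := T)
    have hexp : Real.exp (K * |u - 0|) ≤ Real.exp (K * c) := by
      rw [sub_zero, abs_of_nonneg hu.1]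
      exact Real.exp_le_exp.2 (mul_le_mul_of_nonneg_left hu.2 hK0)
    calc _ ≤ 2 * |κ| * υ * Real.exp (K * |u - 0|) * L := h
      _ ≤ 2 * |κ| * υ * Real.exp (K * c) * L := by gcongr
  rw [← intervalIntegral.integral_sub ((hcont x).intervalIntegrable 0 c)
    ((hcont y).intervalIntegrable 0 c)]
  have hdiffc : Continuous fun u : ℝ =>
      (esAction κ S₀ U (Φ u x) - S₀) - (esAction κ S₀ U (Φ u y) - S₀) := (hcont x).sub (hcont y)
  calc |∫ u in (0 : ℝ)..c, ((esAction κ S₀ U (Φ u x) - S₀) - (esAction κ S₀ U (Φ u y) - S₀))|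
      ≤ ∫ u in (0 : ℝ)..c, |(esAction κ S₀ U (Φ u x) - S₀) - (esAction κ S₀ U (Φ u y) - S₀)| :=
        intervalIntegral.abs_integral_le_integral_abs hc0
    _ ≤ ∫ _u in (0 : ℝ)..c, B :=
        intervalIntegral.integral_mono_on hc0 (hdiffc.abs.intervalIntegrable 0 c)
          intervalIntegrable_const hpt
    _ = c * B := by rw [intervalIntegral.integral_const, smul_eq_mul, sub_zero]
    _ = _ := by rw [hB]; ring

/-! ## §3 The variance of the log-Jacobian: first order in the flow time -/

section Variance

variable [MeasurableSpace E] [BorelSpace E] [Nontrivial E]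

/-- **`Var_π̄(ℓ_{0→c}) ≤ |Λ|·(4|κ|υ·c·e^{Kc})²/4`**: the log-Jacobian of the exact LO flow has
bounded differences `4|κ|υ·c·e^{Kc}` on `Ω` and hence a variance at most linear in the volume and
QUADRATIC in the flow time (Efron–Stein–Popoviciu) — one order in `c` more than the effective
action, whose variance is quartic (`variance_effAction_loFlow_le`). -/
theorem variance_logJac_loFlow_le (hU0 : ∀ n, U n n = 0)
    (hUadj : ∀ m n (v w : E), ⟪U m n v, w⟫ = ⟪v, U n m w⟫) (hd : 2 ≤ Module.finrank ℝ E)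
    (κ S₀ : ℝ) {υ : ℝ} (hυ : ∀ k, ∑ m, ‖U k m‖ ≤ υ) {c : ℝ} (hc0 : 0 ≤ c) :
    ∫ ω, (sphereTDFlowLogJac (G := fun _ : ℝ => loFlowAction κ S₀ U)
          (contDiff_const_family (contDiff_loFlowAction U κ S₀)) T 0 c
            (fun m => ((ω : Λ → sphere (0 : E) 1) m : E)) -
        ∫ ω', sphereTDFlowLogJac (G := fun _ : ℝ => loFlowAction κ S₀ U)
          (contDiff_const_family (contDiff_loFlowAction U κ S₀)) T 0 c
            (fun m => ((ω' : Λ → sphere (0 : E) 1) m : E))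
          ∂Measure.pi (fun _ : Λ => uniformSphere (volume : Measure E))) ^ 2
        ∂Measure.pi (fun _ : Λ => uniformSphere (volume : Measure E)) ≤
      Fintype.card Λ * (4 * |κ| * υ * c *
        Real.exp (3 * |κ| * υ / ((Module.finrank ℝ E : ℝ) - 1) * c)) ^ 2 / 4 := by
  have hcont : Continuous fun ω : Λ → sphere (0 : E) 1 =>
      sphereTDFlowLogJac (G := fun _ : ℝ => loFlowAction κ S₀ U)
        (contDiff_const_family (contDiff_loFlowAction U κ S₀)) T 0 c (fun m => (ω m : E)) :=
    continuous_sphereTDFlowLogJac_sphereConfig (G := fun _ : ℝ => loFlowAction κ S₀ U)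
      (contDiff_const_family (contDiff_loFlowAction U κ S₀))
      (contDiff_const_family (contDiff_loFlowAction U κ S₀)) 0 c (T := T)
  have hD : ∀ (ω : Λ → sphere (0 : E) 1) (k : Λ) (v v' : sphere (0 : E) 1),
      sphereTDFlowLogJac (G := fun _ : ℝ => loFlowAction κ S₀ U)
          (contDiff_const_family (contDiff_loFlowAction U κ S₀)) T 0 c
            (fun m => ((update ω k v) m : E)) -
        sphereTDFlowLogJac (G := fun _ : ℝ => loFlowAction κ S₀ U)
          (contDiff_const_family (contDiff_loFlowAction U κ S₀)) T 0 c
            (fun m => ((update ω k v') m : E)) ≤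
      4 * |κ| * υ * c * Real.exp (3 * |κ| * υ / ((Module.finrank ℝ E : ℝ) - 1) * c) := by
    intro ω k v v'
    rw [sphereConfig_update, sphereConfig_update]
    have hx : ∀ n, ‖update (fun m => (ω m : E)) k (v : E) n‖ = 1 := by
      intro n
      by_cases hn : n = k
      · subst hn; rw [update_self]; exact norm_eq_of_mem_sphere v
      · rw [update_of_ne hn]; exact norm_sphereConfig_eq_one ω n
    have hy : ∀ n, ‖update (fun m => (ω m : E)) k (v' : E) n‖ = 1 := by
      intro n
      by_cases hn : n = k
      · subst hn; rw [update_self]; exact norm_eq_of_mem_sphere v'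
      · rw [update_of_ne hn]; exact norm_sphereConfig_eq_one ω n
    have h := abs_logJac_loFlow_sub_le hU0 hUadj hd κ S₀ hυ hx hy hc0 (T := T)
    have hsum : ∑ j, ‖update (fun m => (ω m : E)) k (v : E) j - update (fun m => (ω m : E)) k (v' : E) j‖
        = ‖(v : E) - (v' : E)‖ := by
      rw [Finset.sum_eq_single k]
      · rw [update_self, update_self]
      · intro j _ hj; rw [update_of_ne hj, update_of_ne hj, sub_self, norm_zero]
      · intro hk; exact absurd (Finset.mem_univ k) hk
    rw [hsum] at h
    have h2 : ‖(v : E) - (v' : E)‖ ≤ 2 := by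
      calc ‖(v : E) - (v' : E)‖ ≤ ‖(v : E)‖ + ‖(v' : E)‖ := norm_sub_le _ _
        _ = 2 := by rw [norm_eq_of_mem_sphere v, norm_eq_of_mem_sphere v']; norm_num
    have hυ0 : 0 ≤ υ := le_trans (Finset.sum_nonneg fun m _ => norm_nonneg _) (hυ k)
    have hA : 0 ≤ 2 * |κ| * υ * c * Real.exp (3 * |κ| * υ / ((Module.finrank ℝ E : ℝ) - 1) * c) := by
      positivity
    calc _ ≤ 2 * |κ| * υ * c * Real.exp (3 * |κ| * υ / ((Module.finrank ℝ E : ℝ) - 1) * c) *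
          ‖(v : E) - (v' : E)‖ := (le_abs_self _).trans h
      _ ≤ 2 * |κ| * υ * c * Real.exp (3 * |κ| * υ / ((Module.finrank ℝ E : ℝ) - 1) * c) * 2 :=
          mul_le_mul_of_nonneg_left h2 hA
      _ = _ := by ring
  have h := variance_le_of_bddDiff (uniformSphere (volume : Measure E)) hcont
    (D := fun _ : Λ => 4 * |κ| * υ * c * Real.exp (3 * |κ| * υ / ((Module.finrank ℝ E : ℝ) - 1) * c))
    hD
  simp only [Finset.sum_const, Finset.card_univ, nsmul_eq_mul] at h
  exact h

end Variance

end Summit.Ventures.LatticeQCDFlow.Exactness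

end
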